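import Summits.CriticalPhenomena.PercolationContinuityZ3.Theorems.PercNearOneGluingNoHeavyLowerTailSahiGridPatternCoCountProductT

/-!
# `NoHeavyLowerTail` (crux stmt-CriticalPhenomena-4575), Sahi programme P1: **THE BLOCK-OR CERTIFICATE VECTOR** for `S ⊕ V = {x : freeOf x ∈ S ∨ cellOf x ∈ V}`:
# slice data of a block-OR, the vector `d'` (frozen block `λ` on `S × V`, `2^k d_S − h_S ν_V` on `S × Vᶜ`, `2^k ν_S + ν̄_S d_V` on `Sᶜ × V`),
# and condition (T) for it from (T) for `S` and `V` (every `n, k`)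

Support file (Sahi cell, seat `prim-sahi-p1`, generation 34; `--supports stmt-CriticalPhenomena-4575`).  Pure proofs, no definitions, no `sorry`,
standard axioms.  Vocabulary of `…SahiGridPattern{,CellForm,SliceForm,DiagCert,DiagCertBlockAndT,CoCountProductT}`.

THE MATHEMATICS (seat memo FROM-prim-sahi-p1-gen34, §3).  For finsets `S ⊆ [3]^n`, `V ⊆ [3]^k` let `A = S ⊕ V ⊆ [3]^{n+k}` be the block-OR
(`glue ξ z ∈ A ↔ ξ ∈ S ∨ z ∈ V`; complement `Sᶜ × Vᶜ`).  Slice data (`ν̄_X := 2^{dim} − ν_X`, the td-count OUTSIDE `X`):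
* `ind_glue_blockOr` (`1_A = 1_S + 1_V − 1_S1_V`), **`nuCount_blockOr`** (`ν_A(glue ξ q) = 2^k ν_S(ξ) + 2^n ν_V(q) − ν_S(ξ)ν_V(q)`, i.e.
  `ν̄_A = ν̄_S ⊗ ν̄_V`), `lamU_blockOr`.
* FROZEN BLOCK (memo §1): for up-sets, `S`-cylinder and `V`-cylinder are independent sub-up-sets of `A`, so every diagonal certificate of `A` equals
  `λ_A = 2^{n+k} + ν̄_S ⊗ ν̄_V` pointwise on `S × V`; the deficits `2^{n+k} − ν̄_S ν̄_V` of `λ_A` on `Sᶜ × Vᶜ` must be paid from `S × Vᶜ` (along the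
  `S`-block) and `Sᶜ × V` (along the `V`-block).  Paying with the certificate transport of `S` scaled by `2^k` on the `Vᶜ`-columns and with
  `ν̄_S(ξ)` copies of the certificate transport of `V` on the `Sᶜ`-rows balances every deficit exactly and gives THE BLOCK-OR VECTOR
    `d'(glue ξ q) = [ξ∈S][q∈V]·(2^{n+k} + h_S(ξ)h_V(q)) + [ξ∈S][q∉V]·(2^k d_S(ξ) − h_S(ξ)ν_V(q)) + [ξ∉S][q∈V]·(2^k ν_S(ξ) + ν̄_S(ξ) d_V(q))`
  (`h_X = 2^{dim}1_X − ν_X` the Harris density; for `n = 1`, `S = {t ≥ 1}` / `{t = 2}` with `d_S = (0,2,2)` / `(0,0,2)` this is EXACTLY the literal-OR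
  certificate of `…DiagCertLiteralOr` / `…DiagCertLiteralTwoOr`).
**THEOREM (`diagCert_blockOr_T`, every `n, k`).**  If `d_S` satisfies (T) for `S` and vanishes off `S`, and `d_V` satisfies (T) for `V` and vanishes
off `V`, then `d'` satisfies (T) for `A = S ⊕ V`.  PROOF: the pointwise identity (`lamU_sub_blockOr_pointwise`)
    `λ_A(glue ξ q) − d'(glue ξ q) = 2^k·(1 − 1_V(q))·(λ_S(ξ) − d_S(ξ)) + ν̄_S(ξ)·(1 − 1_S(ξ))·(λ_V(q) − d_V(q))`,
summed over an up-set `W` by fibres `W_q` ((T) for `S`) and sections `W^ξ` ((T) for `V`), with the weights `2^k(1 − 1_V) ≥ 0`, `ν̄_S(1 − 1_S) ≥ 0`.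
STATUS OF (N) (honest label).  (N) for `d'` (and for its mirror image with the roles of the blocks exchanged, and for their average, which is
always `≥ 0`) is NOT proved here; exact/heuristic verification: memo §3 (kit j253780, j253966: `(n,k) = (1,2), (2,1)` all integer certificate pairs
exact, `(2,2)` sampled + exact confirmations; `0` counterexamples).  Nothing here asserts `PatternPos d` for `d ≥ 4`. [this work]
-/

namespace Summit.CriticalPhenomena.PercolationContinuityZ3.Theorems.SahiGridPattern

open Finset SahiGrid3
open scoped BigOperators

variable {n k : ℕ} {S : Finset (Pd n)} {V : Finset (Pd k)} {A : Finset (Pd (n + k))}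

/-! ### Slice data of a block-OR -/

/-- Indicator of the block-OR: `1_A(glue ξ z) = 1_S(ξ) + 1_V(z) − 1_S(ξ)1_V(z)`. [this work] -/
theorem ind_glue_blockOr (hA : ∀ ξ z, glue ξ z ∈ A ↔ (ξ ∈ S ∨ z ∈ V)) (ξ : Pd n) (z : Pd k) :
    ind A (glue ξ z) = ind S ξ + ind V z - ind S ξ * ind V z := by
  unfold ind
  simp only [hA]
  by_cases h1 : ξ ∈ S <;> by_cases h2 : z ∈ V <;> simp [h1, h2]

/-- **`ν` of a block-OR**: `ν_{S⊕V}(glue ξ q) = 2^k·ν_S(ξ) + 2^n·ν_V(q) − ν_S(ξ)·ν_V(q)` (equivalently `ν̄_{S⊕V} = ν̄_S ⊗ ν̄_V`). [this work] -/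
theorem nuCount_blockOr (hA : ∀ ξ z, glue ξ z ∈ A ↔ (ξ ∈ S ∨ z ∈ V)) (ξ : Pd n) (q : Pd k) :
    (nuCount A (glue ξ q) : ℤ) = 2 ^ k * (nuCount S ξ : ℤ) + 2 ^ n * (nuCount V q : ℤ) - (nuCount S ξ : ℤ) * (nuCount V q : ℤ) := by
  have hfac : ∀ (η : Pd n) (r : Pd k), ind A (glue η r) * (if TotDist (glue η r) (glue ξ q) = true then (1:ℤ) else 0)
      = (ind S η + ind V r - ind S η * ind V r) * ((if TotDist η ξ = true then (1:ℤ) else 0) * (if TotDist r q = true then (1:ℤ) else 0)) := by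
    intro η r
    rw [ind_glue_blockOr hA]
    by_cases h : TotDist (glue η r) (glue ξ q) = true
    · obtain ⟨h1, h2⟩ := (totDist_glue η ξ r q).1 h
      rw [if_pos h, if_pos h1, if_pos h2]; ring
    · rw [if_neg h]
      have hn : ¬ (TotDist η ξ = true ∧ TotDist r q = true) := fun hh => h ((totDist_glue η ξ r q).2 hh)
      by_cases h1 : TotDist η ξ = true
      · have h2 : ¬ TotDist r q = true := fun h2 => hn ⟨h1, h2⟩
        rw [if_pos h1, if_neg h2]; ring
      · rw [if_neg h1]; ring
  have hS : (nuCount S ξ : ℤ) = ∑ η : Pd n, ind S η * (if TotDist η ξ = true then (1:ℤ) else 0) := nuCount_eq_sum_ind S ξ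
  have hV : (nuCount V q : ℤ) = ∑ r : Pd k, ind V r * (if TotDist r q = true then (1:ℤ) else 0) := nuCount_eq_sum_ind V q
  have h2n : (∑ η : Pd n, if TotDist η ξ = true then (1:ℤ) else 0) = 2 ^ n := sum_ite_totDist_eq_pow ξ
  have h2k : (∑ r : Pd k, if TotDist r q = true then (1:ℤ) else 0) = 2 ^ k := sum_ite_totDist_eq_pow q
  rw [nuCount_eq_sum_ind, sum_glue]
  simp only [hfac]
  have inner : ∀ η : Pd n, (∑ r : Pd k, (ind S η + ind V r - ind S η * ind V r) *
      ((if TotDist η ξ = true then (1:ℤ) else 0) * (if TotDist r q = true then (1:ℤ) else 0)))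
      = (if TotDist η ξ = true then (1:ℤ) else 0) * (ind S η * 2 ^ k + (1 - ind S η) * (nuCount V q : ℤ)) := by
    intro η
    have e1 : ind S η * (2:ℤ) ^ k = ∑ r : Pd k, ind S η * (if TotDist r q = true then (1:ℤ) else 0) := by
      rw [← h2k, Finset.mul_sum]
    have e2 : (1 - ind S η) * (nuCount V q : ℤ) = ∑ r : Pd k, (1 - ind S η) * (ind V r * (if TotDist r q = true then (1:ℤ) else 0)) := by
      rw [hV, Finset.mul_sum]
    rw [e1, e2, ← Finset.sum_add_distrib, Finset.mul_sum]
    exact Finset.sum_congr rfl (fun r _ => by ring)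
  simp only [inner]
  have f1 : (2:ℤ) ^ k * (nuCount S ξ : ℤ) = ∑ η : Pd n, (2:ℤ) ^ k * (ind S η * (if TotDist η ξ = true then (1:ℤ) else 0)) := by
    rw [hS, Finset.mul_sum]
  have f2 : (2:ℤ) ^ n * (nuCount V q : ℤ) = ∑ η : Pd n, (if TotDist η ξ = true then (1:ℤ) else 0) * (nuCount V q : ℤ) := by
    rw [← h2n, Finset.sum_mul]
  have f3 : (nuCount S ξ : ℤ) * (nuCount V q : ℤ) = ∑ η : Pd n, ind S η * (if TotDist η ξ = true then (1:ℤ) else 0) * (nuCount V q : ℤ) := by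
    rw [hS, Finset.sum_mul]
  rw [f1, f2, f3, ← Finset.sum_add_distrib, ← Finset.sum_sub_distrib]
  exact Finset.sum_congr rfl (fun η _ => by ring)

/-- **`λ` of a block-OR** at a glued point. [this work] -/
theorem lamU_blockOr (hA : ∀ ξ z, glue ξ z ∈ A ↔ (ξ ∈ S ∨ z ∈ V)) (ξ : Pd n) (q : Pd k) :
    lamU A (glue ξ q) = 2 * (2:ℤ) ^ (n + k) * (ind S ξ + ind V q - ind S ξ * ind V q)
      - (2 ^ k * (nuCount S ξ : ℤ) + 2 ^ n * (nuCount V q : ℤ) - (nuCount S ξ : ℤ) * (nuCount V q : ℤ)) := by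
  unfold lamU
  rw [ind_glue_blockOr hA, nuCount_blockOr hA]

/-! ### The block-OR vector and its (T) condition -/

/-- **The pointwise identity behind the block-OR vector**: with
`d'(glue ξ q) = 1_S1_V·(2^{n+k} + h_S h_V) + 1_S(1−1_V)·(2^k d_S − h_S ν_V) + (1−1_S)1_V·(2^k ν_S + ν̄_S d_V)` and `d_S = 0` off `S`, `d_V = 0` off `V`:
`λ_A(glue ξ q) − d'(glue ξ q) = 2^k(1 − 1_V(q))(λ_S(ξ) − d_S(ξ)) + ν̄_S(ξ)(1 − 1_S(ξ))(λ_V(q) − d_V(q))`. [this work] -/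
theorem lamU_sub_blockOr_pointwise (hA : ∀ ξ z, glue ξ z ∈ A ↔ (ξ ∈ S ∨ z ∈ V)) (dS : Pd n → ℤ) (dV : Pd k → ℤ)
    (hS0 : ∀ ξ, ξ ∉ S → dS ξ = 0) (hV0 : ∀ q, q ∉ V → dV q = 0) (ξ : Pd n) (q : Pd k) :
    lamU A (glue ξ q) -
      ( ind S ξ * ind V q * ((2:ℤ) ^ (n + k) + (2 ^ n * ind S ξ - (nuCount S ξ : ℤ)) * (2 ^ k * ind V q - (nuCount V q : ℤ)))
      + ind S ξ * (1 - ind V q) * (2 ^ k * dS ξ - (2 ^ n * ind S ξ - (nuCount S ξ : ℤ)) * (nuCount V q : ℤ))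
      + (1 - ind S ξ) * ind V q * (2 ^ k * (nuCount S ξ : ℤ) + (2 ^ n - (nuCount S ξ : ℤ)) * dV q) )
    = 2 ^ k * (1 - ind V q) * (lamU S ξ - dS ξ) + (2 ^ n - (nuCount S ξ : ℤ)) * (1 - ind S ξ) * (lamU V q - dV q) := by
  rw [lamU_blockOr hA]
  unfold lamU
  rw [pow_add]
  by_cases h1 : ξ ∈ S <;> by_cases h2 : q ∈ V
  · have e1 : ind S ξ = 1 := by unfold ind; rw [if_pos h1]
    have e2 : ind V q = 1 := by unfold ind; rw [if_pos h2]
    rw [e1, e2]; ring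
  · have e1 : ind S ξ = 1 := by unfold ind; rw [if_pos h1]
    have e2 : ind V q = 0 := by unfold ind; rw [if_neg h2]
    rw [e1, e2, hV0 q h2]; ring
  · have e1 : ind S ξ = 0 := by unfold ind; rw [if_neg h1]
    have e2 : ind V q = 1 := by unfold ind; rw [if_pos h2]
    rw [e1, e2, hS0 ξ h1]; ring
  · have e1 : ind S ξ = 0 := by unfold ind; rw [if_neg h1]
    have e2 : ind V q = 0 := by unfold ind; rw [if_neg h2]
    rw [e1, e2, hS0 ξ h1, hV0 q h2]; ring

/-- **THEOREM (`(T)` for the block-OR vector; every `n, k`).**  `S ⊆ [3]^n`, `V ⊆ [3]^k` arbitrary finsets, `A = S ⊕ V`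
(`glue ξ z ∈ A ↔ ξ ∈ S ∨ z ∈ V`); `d_S` with (T) for `S` vanishing off `S`, `d_V` with (T) for `V` vanishing off `V`.  Then the block-OR vector
`d'(x)` (frozen value on `S×V`, `2^k d_S − h_S ν_V` on `S×Vᶜ`, `2^k ν_S + ν̄_S d_V` on `Sᶜ×V`, `0` on `Sᶜ×Vᶜ`) satisfies (T) for `A`:
`Σ_{x∈W} d'(x) ≤ Σ_{x∈W} λ_A(x)` for every up-set `W ⊆ [3]^{n+k}`. [this work] -/
theorem diagCert_blockOr_T (hA : ∀ ξ z, glue ξ z ∈ A ↔ (ξ ∈ S ∨ z ∈ V)) (dS : Pd n → ℤ) (dV : Pd k → ℤ)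
    (hTS : ∀ W : Finset (Pd n), IsUpperSet (W : Set (Pd n)) → (∑ ξ ∈ W, dS ξ) ≤ ∑ ξ ∈ W, lamU S ξ)
    (hTV : ∀ W : Finset (Pd k), IsUpperSet (W : Set (Pd k)) → (∑ q ∈ W, dV q) ≤ ∑ q ∈ W, lamU V q)
    (hS0 : ∀ ξ, ξ ∉ S → dS ξ = 0) (hV0 : ∀ q, q ∉ V → dV q = 0)
    {W : Finset (Pd (n + k))} (hW : IsUpperSet (W : Set (Pd (n + k)))) :
    (∑ x ∈ W,
      ( ind S (freeOf x) * ind V (cellOf x) * ((2:ℤ) ^ (n + k)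
          + (2 ^ n * ind S (freeOf x) - (nuCount S (freeOf x) : ℤ)) * (2 ^ k * ind V (cellOf x) - (nuCount V (cellOf x) : ℤ)))
      + ind S (freeOf x) * (1 - ind V (cellOf x)) * (2 ^ k * dS (freeOf x) - (2 ^ n * ind S (freeOf x) - (nuCount S (freeOf x) : ℤ)) * (nuCount V (cellOf x) : ℤ))
      + (1 - ind S (freeOf x)) * ind V (cellOf x) * (2 ^ k * (nuCount S (freeOf x) : ℤ) + (2 ^ n - (nuCount S (freeOf x) : ℤ)) * dV (cellOf x)) ))
      ≤ ∑ x ∈ W, lamU A x := by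
  rw [← sub_nonneg, ← Finset.sum_sub_distrib, sum_mem_eq_sum_glue]
  simp only [freeOf_glue, cellOf_glue]
  have hpt : ∀ (ξ : Pd n) (q : Pd k), ind W (glue ξ q) * (lamU A (glue ξ q) -
      ( ind S ξ * ind V q * ((2:ℤ) ^ (n + k) + (2 ^ n * ind S ξ - (nuCount S ξ : ℤ)) * (2 ^ k * ind V q - (nuCount V q : ℤ)))
      + ind S ξ * (1 - ind V q) * (2 ^ k * dS ξ - (2 ^ n * ind S ξ - (nuCount S ξ : ℤ)) * (nuCount V q : ℤ))
      + (1 - ind S ξ) * ind V q * (2 ^ k * (nuCount S ξ : ℤ) + (2 ^ n - (nuCount S ξ : ℤ)) * dV q) ))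
      = 2 ^ k * (1 - ind V q) * (ind W (glue ξ q) * (lamU S ξ - dS ξ))
        + (2 ^ n - (nuCount S ξ : ℤ)) * (1 - ind S ξ) * (ind W (glue ξ q) * (lamU V q - dV q)) := by
    intro ξ q
    rw [lamU_sub_blockOr_pointwise hA dS dV hS0 hV0 ξ q]
    ring
  simp only [hpt, Finset.sum_add_distrib]
  -- `S`-block: fibres `W_q`, weight `2^k (1 − 1_V(q)) ≥ 0`
  have h1 : 0 ≤ ∑ ξ : Pd n, ∑ q : Pd k, 2 ^ k * (1 - ind V q) * (ind W (glue ξ q) * (lamU S ξ - dS ξ)) := by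
    rw [Finset.sum_comm]
    refine Finset.sum_nonneg fun q _ => ?_
    rw [← Finset.mul_sum, sum_ind_glue_mul_eq_sum_fibre, Finset.sum_sub_distrib]
    have hv : (0:ℤ) ≤ 1 - ind V q := by unfold ind; split_ifs <;> norm_num
    refine mul_nonneg (mul_nonneg (pow_nonneg (by norm_num) k) hv) ?_
    linarith [hTS (fibre W q) (isUpperSet_fibre hW q)]
  -- `V`-block: sections `W^ξ`, weight `ν̄_S(ξ)(1 − 1_S(ξ)) ≥ 0`
  have h2 : 0 ≤ ∑ ξ : Pd n, ∑ q : Pd k, (2 ^ n - (nuCount S ξ : ℤ)) * (1 - ind S ξ) * (ind W (glue ξ q) * (lamU V q - dV q)) := by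
    refine Finset.sum_nonneg fun ξ _ => ?_
    rw [← Finset.mul_sum, sum_ind_glue_mul_eq_sum_sect, Finset.sum_sub_distrib]
    have hs : (0:ℤ) ≤ 1 - ind S ξ := by unfold ind; split_ifs <;> norm_num
    have hν : (0:ℤ) ≤ 2 ^ n - (nuCount S ξ : ℤ) := by linarith [nuCount_le_two_pow S ξ]
    refine mul_nonneg (mul_nonneg hν hs) ?_
    linarith [hTV (sect W ξ) (isUpperSet_sect hW ξ)]
  linarith

/-- **The literal instances.**  For `n = 1`, `S = {t ≥ 1}` with `d_S = (0,2,2)`: at `ξ 0 = 0` the block-OR vector is `2·2^k·1_V(q)` and at `ξ 0 ≥ 1`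
it is `2·2^k + (2^k 1_V(q) − ν_V(q))` — the certificate of `…DiagCertLiteralOr` (values of `ν_S`: `2, 1, 1`).  Recorded as the arithmetic of the
three entries given those slice values. [this work] -/
theorem blockOr_literalOne_values (dV : Pd k → ℤ) (q : Pd k) :
    -- level 0 (ξ ∉ S, ν_S = 2, n = 1): `2^k·2 + (2 − 2)·d_V = 2·2^k` on `V`, `0` off `V`
    ((1 - (0:ℤ)) * ind V q * (2 ^ k * (2:ℤ) + (2 ^ 1 - (2:ℤ)) * dV q) = 2 * 2 ^ k * ind V q)
    -- levels 1, 2 (ξ ∈ S, ν_S = 1, d_S = 2): `1_V·(2^{1+k} + 1·(2^k − ν_V)) + (1 − 1_V)·(2^k·2 − 1·ν_V) = 2·2^k + (2^k 1_V − ν_V)`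
    ∧ ((1:ℤ) * ind V q * ((2:ℤ) ^ (1 + k) + (2 ^ 1 * (1:ℤ) - 1) * (2 ^ k * ind V q - (nuCount V q : ℤ)))
        + (1:ℤ) * (1 - ind V q) * (2 ^ k * (2:ℤ) - (2 ^ 1 * (1:ℤ) - 1) * (nuCount V q : ℤ))
        = 2 * 2 ^ k + (2 ^ k * ind V q - (nuCount V q : ℤ))) := by
  refine ⟨by ring, ?_⟩
  rw [pow_add]
  by_cases h : q ∈ V
  · have e : ind V q = 1 := by unfold ind; rw [if_pos h]
    rw [e]; ring
  · have e : ind V q = 0 := by unfold ind; rw [if_neg h]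
    rw [e]; ring

/-! ### The mirror vector OR8m and the symmetric vector OR8h = ½(OR8 + OR8m) (appended, generation 34) -/

/-- **Pointwise identity for the MIRROR block-OR vector** (roles of the blocks exchanged):
`d''(glue ξ q) = 1_S1_V·(2^{n+k} + h_S h_V) + (1−1_S)1_V·(2^n d_V − h_V ν_S) + 1_S(1−1_V)·(2^n ν_V + ν̄_V d_S)` satisfies
`λ_A − d'' = 2^n(1 − 1_S(ξ))(λ_V(q) − d_V(q)) + ν̄_V(q)(1 − 1_V(q))(λ_S(ξ) − d_S(ξ))`. [this work] -/
theorem lamU_sub_blockOrMirror_pointwise (hA : ∀ ξ z, glue ξ z ∈ A ↔ (ξ ∈ S ∨ z ∈ V)) (dS : Pd n → ℤ) (dV : Pd k → ℤ)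
    (hS0 : ∀ ξ, ξ ∉ S → dS ξ = 0) (hV0 : ∀ q, q ∉ V → dV q = 0) (ξ : Pd n) (q : Pd k) :
    lamU A (glue ξ q) -
      ( ind S ξ * ind V q * ((2:ℤ) ^ (n + k) + (2 ^ n * ind S ξ - (nuCount S ξ : ℤ)) * (2 ^ k * ind V q - (nuCount V q : ℤ)))
      + (1 - ind S ξ) * ind V q * (2 ^ n * dV q - (2 ^ k * ind V q - (nuCount V q : ℤ)) * (nuCount S ξ : ℤ))
      + ind S ξ * (1 - ind V q) * (2 ^ n * (nuCount V q : ℤ) + (2 ^ k - (nuCount V q : ℤ)) * dS ξ) )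
    = 2 ^ n * (1 - ind S ξ) * (lamU V q - dV q) + (2 ^ k - (nuCount V q : ℤ)) * (1 - ind V q) * (lamU S ξ - dS ξ) := by
  rw [lamU_blockOr hA]
  unfold lamU
  rw [pow_add]
  by_cases h1 : ξ ∈ S <;> by_cases h2 : q ∈ V
  · have e1 : ind S ξ = 1 := by unfold ind; rw [if_pos h1]
    have e2 : ind V q = 1 := by unfold ind; rw [if_pos h2]
    rw [e1, e2]; ring
  · have e1 : ind S ξ = 1 := by unfold ind; rw [if_pos h1]
    have e2 : ind V q = 0 := by unfold ind; rw [if_neg h2]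
    rw [e1, e2, hV0 q h2]; ring
  · have e1 : ind S ξ = 0 := by unfold ind; rw [if_neg h1]
    have e2 : ind V q = 1 := by unfold ind; rw [if_pos h2]
    rw [e1, e2, hS0 ξ h1]; ring
  · have e1 : ind S ξ = 0 := by unfold ind; rw [if_neg h1]
    have e2 : ind V q = 0 := by unfold ind; rw [if_neg h2]
    rw [e1, e2, hS0 ξ h1, hV0 q h2]; ring

/-- **(T) for the mirror block-OR vector OR8m** (every `n, k`): same hypotheses as `diagCert_blockOr_T`. [this work] -/
theorem diagCert_blockOrMirror_T (hA : ∀ ξ z, glue ξ z ∈ A ↔ (ξ ∈ S ∨ z ∈ V)) (dS : Pd n → ℤ) (dV : Pd k → ℤ)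
    (hTS : ∀ W : Finset (Pd n), IsUpperSet (W : Set (Pd n)) → (∑ ξ ∈ W, dS ξ) ≤ ∑ ξ ∈ W, lamU S ξ)
    (hTV : ∀ W : Finset (Pd k), IsUpperSet (W : Set (Pd k)) → (∑ q ∈ W, dV q) ≤ ∑ q ∈ W, lamU V q)
    (hS0 : ∀ ξ, ξ ∉ S → dS ξ = 0) (hV0 : ∀ q, q ∉ V → dV q = 0)
    {W : Finset (Pd (n + k))} (hW : IsUpperSet (W : Set (Pd (n + k)))) :
    (∑ x ∈ W,
      ( ind S (freeOf x) * ind V (cellOf x) * ((2:ℤ) ^ (n + k)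
          + (2 ^ n * ind S (freeOf x) - (nuCount S (freeOf x) : ℤ)) * (2 ^ k * ind V (cellOf x) - (nuCount V (cellOf x) : ℤ)))
      + (1 - ind S (freeOf x)) * ind V (cellOf x) * (2 ^ n * dV (cellOf x) - (2 ^ k * ind V (cellOf x) - (nuCount V (cellOf x) : ℤ)) * (nuCount S (freeOf x) : ℤ))
      + ind S (freeOf x) * (1 - ind V (cellOf x)) * (2 ^ n * (nuCount V (cellOf x) : ℤ) + (2 ^ k - (nuCount V (cellOf x) : ℤ)) * dS (freeOf x)) ))
      ≤ ∑ x ∈ W, lamU A x := by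
  rw [← sub_nonneg, ← Finset.sum_sub_distrib, sum_mem_eq_sum_glue]
  simp only [freeOf_glue, cellOf_glue]
  have hpt : ∀ (ξ : Pd n) (q : Pd k), ind W (glue ξ q) * (lamU A (glue ξ q) -
      ( ind S ξ * ind V q * ((2:ℤ) ^ (n + k) + (2 ^ n * ind S ξ - (nuCount S ξ : ℤ)) * (2 ^ k * ind V q - (nuCount V q : ℤ)))
      + (1 - ind S ξ) * ind V q * (2 ^ n * dV q - (2 ^ k * ind V q - (nuCount V q : ℤ)) * (nuCount S ξ : ℤ))
      + ind S ξ * (1 - ind V q) * (2 ^ n * (nuCount V q : ℤ) + (2 ^ k - (nuCount V q : ℤ)) * dS ξ) ))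
      = 2 ^ n * (1 - ind S ξ) * (ind W (glue ξ q) * (lamU V q - dV q))
        + (2 ^ k - (nuCount V q : ℤ)) * (1 - ind V q) * (ind W (glue ξ q) * (lamU S ξ - dS ξ)) := by
    intro ξ q
    rw [lamU_sub_blockOrMirror_pointwise hA dS dV hS0 hV0 ξ q]
    ring
  simp only [hpt, Finset.sum_add_distrib]
  have h1 : 0 ≤ ∑ ξ : Pd n, ∑ q : Pd k, 2 ^ n * (1 - ind S ξ) * (ind W (glue ξ q) * (lamU V q - dV q)) := by
    refine Finset.sum_nonneg fun ξ _ => ?_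
    rw [← Finset.mul_sum, sum_ind_glue_mul_eq_sum_sect, Finset.sum_sub_distrib]
    have hs : (0:ℤ) ≤ 1 - ind S ξ := by unfold ind; split_ifs <;> norm_num
    refine mul_nonneg (mul_nonneg (pow_nonneg (by norm_num) n) hs) ?_
    linarith [hTV (sect W ξ) (isUpperSet_sect hW ξ)]
  have h2 : 0 ≤ ∑ ξ : Pd n, ∑ q : Pd k, (2 ^ k - (nuCount V q : ℤ)) * (1 - ind V q) * (ind W (glue ξ q) * (lamU S ξ - dS ξ)) := by
    rw [Finset.sum_comm]
    refine Finset.sum_nonneg fun q _ => ?_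
    rw [← Finset.mul_sum, sum_ind_glue_mul_eq_sum_fibre, Finset.sum_sub_distrib]
    have hv : (0:ℤ) ≤ 1 - ind V q := by unfold ind; split_ifs <;> norm_num
    have hν : (0:ℤ) ≤ 2 ^ k - (nuCount V q : ℤ) := by linarith [nuCount_le_two_pow V q]
    refine mul_nonneg (mul_nonneg hν hv) ?_
    linarith [hTS (fibre W q) (isUpperSet_fibre hW q)]
  linarith

/-- **(T) for the SYMMETRIC block-OR vector OR8h = ½(OR8 + OR8m)**, stated integrally as `Σ_W (OR8 + OR8m) ≤ 2·Σ_W λ_A`.  OR8h is symmetric under exchanging the blocks,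
always `≥ 0` when `d_S, d_V ≥ 0` (since `h_S ≤ 2^n` on `S`), and is the vector for which condition (N) was verified in every tested certificate pair (seat memo §3);
its (N) condition (CONJECTURE B) is not asserted here. [this work] -/
theorem diagCert_blockOrSym_T (hA : ∀ ξ z, glue ξ z ∈ A ↔ (ξ ∈ S ∨ z ∈ V)) (dS : Pd n → ℤ) (dV : Pd k → ℤ)
    (hTS : ∀ W : Finset (Pd n), IsUpperSet (W : Set (Pd n)) → (∑ ξ ∈ W, dS ξ) ≤ ∑ ξ ∈ W, lamU S ξ)
    (hTV : ∀ W : Finset (Pd k), IsUpperSet (W : Set (Pd k)) → (∑ q ∈ W, dV q) ≤ ∑ q ∈ W, lamU V q)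
    (hS0 : ∀ ξ, ξ ∉ S → dS ξ = 0) (hV0 : ∀ q, q ∉ V → dV q = 0)
    {W : Finset (Pd (n + k))} (hW : IsUpperSet (W : Set (Pd (n + k)))) :
    (∑ x ∈ W,
      (( ind S (freeOf x) * ind V (cellOf x) * ((2:ℤ) ^ (n + k)
          + (2 ^ n * ind S (freeOf x) - (nuCount S (freeOf x) : ℤ)) * (2 ^ k * ind V (cellOf x) - (nuCount V (cellOf x) : ℤ)))
      + ind S (freeOf x) * (1 - ind V (cellOf x)) * (2 ^ k * dS (freeOf x) - (2 ^ n * ind S (freeOf x) - (nuCount S (freeOf x) : ℤ)) * (nuCount V (cellOf x) : ℤ))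
      + (1 - ind S (freeOf x)) * ind V (cellOf x) * (2 ^ k * (nuCount S (freeOf x) : ℤ) + (2 ^ n - (nuCount S (freeOf x) : ℤ)) * dV (cellOf x)) )
      + ( ind S (freeOf x) * ind V (cellOf x) * ((2:ℤ) ^ (n + k)
          + (2 ^ n * ind S (freeOf x) - (nuCount S (freeOf x) : ℤ)) * (2 ^ k * ind V (cellOf x) - (nuCount V (cellOf x) : ℤ)))
      + (1 - ind S (freeOf x)) * ind V (cellOf x) * (2 ^ n * dV (cellOf x) - (2 ^ k * ind V (cellOf x) - (nuCount V (cellOf x) : ℤ)) * (nuCount S (freeOf x) : ℤ))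
      + ind S (freeOf x) * (1 - ind V (cellOf x)) * (2 ^ n * (nuCount V (cellOf x) : ℤ) + (2 ^ k - (nuCount V (cellOf x) : ℤ)) * dS (freeOf x)) )))
      ≤ 2 * ∑ x ∈ W, lamU A x := by
  rw [Finset.sum_add_distrib, two_mul]
  exact add_le_add (diagCert_blockOr_T hA dS dV hTS hTV hS0 hV0 hW) (diagCert_blockOrMirror_T hA dS dV hTS hTV hS0 hV0 hW)

/-! ### Status note on condition (N) for the block-OR vectors (appended, generation 34, after the `(3,3)` census)

HONEST LABEL (supersedes the evidence sentences in the docstrings above, which describe the tests of total dimension `≤ 4` only).  Condition (N) for OR8 / OR8m /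
OR8h is NOT true for arbitrary certificates of arbitrary blocks: for random pairs of up-sets `S, V ⊆ [3]^3` with LP-balanced certificates the symmetric vector
OR8h violates (N) in `18/300` pairs (kit j254870; e.g. `S = ↑{012,111,120,210}`, `V = ↑{002,121,211}`, margin `−12` at an explicit up-set pair), and with
top-heavy (⪰-maximal) certificates in `1/171` (j255116); OR8 and OR8m fail similarly (their validity is ⪯-monotone in `d_S` resp. `d_V`).  No failure occurs
(i) for any pair of total dimension `≤ 4` (all integer certificates of all up-sets of `[3]^1, [3]^2`, exact), nor (ii) anywhere inside the READ-ONCE recursion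
(literals `(0,2,2)/(0,0,2)`, AND ↦ co-count product of `…CoCountProductT`, OR ↦ OR8h): six 4-variable formulas exactly over all `17 792 748` up-sets of `[3]^4`
and `420` five/six-variable formulas heuristically (j254499, j255054, j255055) — seat memo FROM-prim-sahi-p1-gen34 §3.4 ("Conjecture RO").  The theorems of
this file ((T) for OR8, OR8m, OR8h; the block-OR slice data) are unaffected. -/


end Summit.CriticalPhenomena.PercolationContinuityZ3.Theorems.SahiGridPattern
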